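import Literature.NumberTheory.Sieve.PolymathGEHPrimeTupleFamily
import Literature.NumberTheory.Sieve.PolymathGEHLambdaConst
import HarnessLib

/-!
# The fundamental-theorem-of-arithmetic decomposition of §4.5 (combinatorial layer)

Trunk AntSieve, tooling toward the named fact `Literature.NumberTheory.Sieve.weakDHL_three_two_of_GEH`
(D. H. J. Polymath, Res. Math. Sci. 1:12 (2014) = arXiv:1407.4897, Theorem 3.2(xii)).

§4.5, p. 17: "if we partition `[x^ε, 2x+h_k]` by `O(log^{A+1} x)` intervals `I_1,…,I_m` … then we
have `p_i ∈ I_{j_i}` for some `1 ≤ j_1 ≤ … ≤ j_r ≤ m` … it suffices to show [the level bound for]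
`Δ(λ_{F_k} λ_{G_k} 1_{A_{j_1,…,j_r}}; a (q))` … one can write `1_{A_{j_1,…,j_r}}` as a convolution".
This file is the bookkeeping behind that sentence, for an abstract monotone grid `c : ℕ → ℕ` with
pieces `P_j = primes ∩ (c_j, c_{j+1}]`, `j ≤ J`:

* `gridPiece`, `gridIndex` (`jOf`: the piece containing a prime), `idxList n` (the sorted list of
  piece indices of the prime factors of `n`, with multiplicity), `monoTuples r J` (the non-decreasing
  index tuples `τ : Fin r → ℕ`, entries `≤ J`);
* `sum_monoTuples_ite_eq` — every `n` whose prime factors lie in `(c_0, c_{J+1}]`, with at most `R₀`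
  of them, matches EXACTLY ONE tuple: `Σ_{r ≤ R₀} Σ_{τ} [idxList n = ofFn τ] g = g`;
* `prod_mem_tupleProducts`, `mem_tupleProducts_of_idxList_eq` — a matching `n` lies in the tuple
  product set `tupleProducts [P_{τ(r-1)}, …, P_{τ 0}]` of `PolymathGEHPrimeTuples.lean`, and
  `one_le_conv_of_mem_tupleProducts`: its indicator is majorised by the convolution
  `1_{tupleProducts tail} ⋆ 1_{P_{τ(r-1)}}` (also when indices repeat);
* for STRICTLY increasing `τ` ("`j_1 < ⋯ < j_r`"): `pieces_pairwise_of_strictMono` (the sets are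
  increasing, so `setIndicatorAF_tupleProducts_cons` applies: the indicator IS the convolution),
  `idxList_eq_of_mem_tupleProducts` (conversely every element matches `τ`), the box bounds
  `prod_lt_of_mem_tupleProducts`/`le_prod_of_mem_tupleProducts`, and `lambdaModel_eq_modelValue`
  (the model value of `λ_F` only depends on `τ`).

## References

* [Polymath8b2014] D. H. J. Polymath, Res. Math. Sci. 1 (2014), Art. 12 = arXiv:1407.4897,
  §4.5, p. 17.
-/

noncomputable section

open Finset

namespace Literature.NumberTheory.Sieve

open scoped Classical

/-! ### The grid, its pieces and the index of a prime -/

section Grid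

variable (c : ℕ → ℕ) (J : ℕ)

/-- The `j`-th piece: the primes in `(c_j, c_{j+1}]`. [cite: Polymath8b2014, §4.5, p. 17] -/
def gridPiece (j : ℕ) : Finset ℕ := (Ioc (c j) (c (j + 1))).filter Nat.Prime

/-- The index of the piece containing `p`: the number of `j ≤ J` with `c_{j+1} < p`. [cite: Polymath8b2014, §4.5, p. 17] -/
def gridIndex (p : ℕ) : ℕ := ((range (J + 1)).filter (fun j => c (j + 1) < p)).card

/-- Members of a piece are primes in the interval. [folklore] -/
theorem mem_gridPiece {j p : ℕ} : p ∈ gridPiece c j ↔ c j < p ∧ p ≤ c (j + 1) ∧ p.Prime := by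
  simp [gridPiece, and_assoc]

variable {c J}

/-- The defining filter of `gridIndex` is an initial segment. [folklore] -/
theorem filter_lt_eq_range (hc : Monotone c) {j p : ℕ} (hj : j ≤ J) (h1 : c j < p) (h2 : p ≤ c (j + 1)) :
    (range (J + 1)).filter (fun i => c (i + 1) < p) = range j := by
  ext i
  simp only [Finset.mem_filter, Finset.mem_range]
  constructor
  · rintro ⟨-, hi⟩
    by_contra hij
    push Not at hij
    have : c (j + 1) ≤ c (i + 1) := hc (by omega)
    omega
  · intro hij
    refine ⟨by omega, lt_of_le_of_lt (hc (by omega)) h1⟩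

/-- `gridIndex p = j` when `c_j < p ≤ c_{j+1}`, `j ≤ J`. [folklore] -/
theorem gridIndex_eq (hc : Monotone c) {j p : ℕ} (hj : j ≤ J) (h1 : c j < p) (h2 : p ≤ c (j + 1)) :
    gridIndex c J p = j := by
  rw [gridIndex, filter_lt_eq_range hc hj h1 h2, Finset.card_range]

/-- Every `p ∈ (c_0, c_{J+1}]` lies in some piece. [folklore] -/
theorem exists_gridIndex {p : ℕ} (hp0 : c 0 < p) (hpJ : p ≤ c (J + 1)) :
    ∃ j, j ≤ J ∧ c j < p ∧ p ≤ c (j + 1) := by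
  have hex : ∃ i, p ≤ c (i + 1) := ⟨J, hpJ⟩
  set j := Nat.find hex with hjdef
  have hj : p ≤ c (j + 1) := Nat.find_spec hex
  have hjJ : j ≤ J := Nat.find_min' hex hpJ
  refine ⟨j, hjJ, ?_, hj⟩
  rcases Nat.eq_zero_or_pos j with h0 | hpos
  · rw [h0]; exact hp0
  · have hmin : ¬ p ≤ c ((j - 1) + 1) := Nat.find_min hex (by omega)
    rw [Nat.sub_add_cancel hpos] at hmin
    omega

/-- The defining property of `gridIndex`. [folklore] -/
theorem gridIndex_spec (hc : Monotone c) {p : ℕ} (hp0 : c 0 < p) (hpJ : p ≤ c (J + 1)) :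
    gridIndex c J p ≤ J ∧ c (gridIndex c J p) < p ∧ p ≤ c (gridIndex c J p + 1) := by
  obtain ⟨j, hjJ, h1, h2⟩ := exists_gridIndex (c := c) (J := J) hp0 hpJ
  rw [gridIndex_eq hc hjJ h1 h2]
  exact ⟨hjJ, h1, h2⟩

/-- A prime of `(c_0, c_{J+1}]` belongs to the piece of its index. [folklore] -/
theorem mem_gridPiece_gridIndex (hc : Monotone c) {p : ℕ} (hp : p.Prime) (hp0 : c 0 < p)
    (hpJ : p ≤ c (J + 1)) : p ∈ gridPiece c (gridIndex c J p) := by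
  obtain ⟨-, h1, h2⟩ := gridIndex_spec hc hp0 hpJ
  exact (mem_gridPiece c).2 ⟨h1, h2, hp⟩

/-- Members of the `j`-th piece have index `j`. [folklore] -/
theorem gridIndex_of_mem_gridPiece (hc : Monotone c) {j p : ℕ} (hj : j ≤ J) (hp : p ∈ gridPiece c j) :
    gridIndex c J p = j := by
  obtain ⟨h1, h2, -⟩ := (mem_gridPiece c).1 hp
  exact gridIndex_eq hc hj h1 h2

/-- `gridIndex` is monotone in `p`. [folklore] -/
theorem gridIndex_mono (c : ℕ → ℕ) (J : ℕ) : Monotone (gridIndex c J) := by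
  intro p p' hpp'
  exact Finset.card_le_card (fun i hi => by
    rw [Finset.mem_filter] at hi ⊢
    exact ⟨hi.1, lt_of_lt_of_le hi.2 hpp'⟩)

end Grid

/-! ### The sorted index list of `n` and the tuples -/

section Tuples

variable (c : ℕ → ℕ) (J : ℕ)

/-- The sorted list of piece indices of the prime factors of `n` (with multiplicity). [cite: Polymath8b2014, §4.5, p. 17] -/
def idxList (n : ℕ) : List ℕ := n.primeFactorsList.map (gridIndex c J)

/-- The non-decreasing index tuples `τ : Fin r → {0,…,J}` ("`1 ≤ j_1 ≤ … ≤ j_r ≤ m`"). [cite: Polymath8b2014, §4.5, p. 17] -/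
def monoTuples (r J : ℕ) : Finset (Fin r → ℕ) :=
  (Fintype.piFinset fun _ : Fin r => range (J + 1)).filter fun τ => Monotone τ

/-- Membership in `monoTuples`. [folklore] -/
theorem mem_monoTuples {r J : ℕ} {τ : Fin r → ℕ} : τ ∈ monoTuples r J ↔ (∀ i, τ i ≤ J) ∧ Monotone τ := by
  simp [monoTuples, Fintype.mem_piFinset]

/-- `#monoTuples r J ≤ (J+1)^r`. [folklore] -/
theorem card_monoTuples_le (r J : ℕ) : (monoTuples r J).card ≤ (J + 1) ^ r := by
  refine (Finset.card_le_card (Finset.filter_subset _ _)).trans ?_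
  rw [Fintype.card_piFinset, Finset.prod_const, Finset.card_range, Finset.card_univ, Fintype.card_fin]

variable {c J}

/-- The index list is sorted. [folklore] -/
theorem idxList_sortedLE (n : ℕ) : (idxList c J n).SortedLE := by
  rw [idxList, List.sortedLE_iff_pairwise]
  exact List.Pairwise.map _ (fun a b hab => gridIndex_mono c J hab)
    (List.sortedLE_iff_pairwise.1 (Nat.primeFactorsList_sorted n))

/-- Entries of the index list are `≤ J` when the prime factors lie in `(c_0, c_{J+1}]`. [folklore] -/
theorem forall_idxList_le (hc : Monotone c) {n : ℕ}
    (hfac : ∀ p ∈ n.primeFactorsList, c 0 < p ∧ p ≤ c (J + 1)) : ∀ j ∈ idxList c J n, j ≤ J := by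
  intro j hj
  rw [idxList, List.mem_map] at hj
  obtain ⟨p, hp, rfl⟩ := hj
  exact (gridIndex_spec hc (hfac p hp).1 (hfac p hp).2).1

/-- **Exactly one tuple matches**: for `n` with at most `R₀` prime factors, all in `(c_0, c_{J+1}]`,
and at least one (`n ≥ 2`), `Σ_{1 ≤ r ≤ R₀} Σ_{τ ∈ monoTuples r J} [idxList n = ofFn τ] g = g`. [cite: Polymath8b2014, §4.5, p. 17] -/
theorem sum_monoTuples_ite_eq (hc : Monotone c) {n : ℕ} (hn : 2 ≤ n)
    (hfac : ∀ p ∈ n.primeFactorsList, c 0 < p ∧ p ≤ c (J + 1)) {R₀ : ℕ}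
    (hlen : n.primeFactorsList.length ≤ R₀) (g : ℝ) :
    ∑ r ∈ Icc 1 R₀, ∑ τ ∈ monoTuples r J, (if idxList c J n = List.ofFn τ then g else 0) = g := by
  set l := idxList c J n with hl
  have hlen' : l.length = n.primeFactorsList.length := by rw [hl, idxList, List.length_map]
  have hlpos : 1 ≤ l.length := by
    rw [hlen']
    by_contra h0
    push Not at h0
    have : n.primeFactorsList = [] := List.eq_nil_of_length_eq_zero (by omega)
    rw [Nat.primeFactorsList_eq_nil] at this
    omega
  -- the matching tuple
  set τ₀ : Fin l.length → ℕ := l.get with hτ₀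
  have hτ₀eq : List.ofFn τ₀ = l := List.ofFn_get l
  have hτ₀mem : τ₀ ∈ monoTuples l.length J := by
    rw [mem_monoTuples]
    refine ⟨fun i => forall_idxList_le hc hfac _ (List.get_mem l i), ?_⟩
    exact idxList_sortedLE (c := c) (J := J) n
  -- only `r = l.length` contributes
  rw [Finset.sum_eq_single_of_mem l.length (Finset.mem_Icc.2 ⟨hlpos, hlen'.symm ▸ hlen⟩)]
  · rw [Finset.sum_eq_single_of_mem τ₀ hτ₀mem]
    · rw [if_pos hτ₀eq.symm]
    · intro τ _ hne
      rw [if_neg]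
      intro heq
      apply hne
      apply List.ofFn_injective
      rw [← heq, hτ₀eq]
  · intro r _ hr
    refine Finset.sum_eq_zero fun τ _ => ?_
    rw [if_neg]
    intro heq
    apply hr
    have := congrArg List.length heq
    rw [List.length_ofFn] at this
    exact this.symm

end Tuples

/-! ### Matching `n` lie in the tuple product sets, majorised by the convolution -/

section Products

variable {c : ℕ → ℕ} {J : ℕ}

/-- The list of pieces of a tuple, largest index FIRST (the convention of `tupleProducts`). [cite: Polymath8b2014, §4.5, p. 17] -/
def tuplePieces (c : ℕ → ℕ) {r : ℕ} (τ : Fin r → ℕ) : List (Finset ℕ) :=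
  (List.ofFn fun i => gridPiece c (τ i)).reverse

/-- All members of all pieces are primes. [folklore] -/
theorem prime_of_mem_tuplePieces (c : ℕ → ℕ) {r : ℕ} (τ : Fin r → ℕ) :
    ∀ P ∈ tuplePieces c τ, ∀ p ∈ P, p.Prime := by
  intro P hP p hp
  rw [tuplePieces, List.mem_reverse, List.mem_ofFn] at hP
  obtain ⟨i, rfl⟩ := hP
  exact ((mem_gridPiece c).1 hp).2.2

/-- A product of primes of `(c_0, c_{J+1}]` lies in the tuple product of its pieces. [folklore] -/
theorem prod_mem_tupleProducts (hc : Monotone c) : ∀ (ps : List ℕ),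
    (∀ p ∈ ps, p.Prime ∧ c 0 < p ∧ p ≤ c (J + 1)) →
      ps.prod ∈ tupleProducts ((ps.map fun p => gridPiece c (gridIndex c J p)).reverse) := by
  intro ps
  induction ps using List.reverseRecOn with
  | nil => intro _; simp
  | append_singleton ps p ih =>
    intro h
    have hps : ∀ q ∈ ps, q.Prime ∧ c 0 < q ∧ q ≤ c (J + 1) := fun q hq => h q (List.mem_append_left _ hq)
    have hp := h p (List.mem_append_right _ (List.mem_singleton_self p))
    rw [List.map_append, List.map_singleton, List.reverse_append, List.reverse_singleton,
      List.singleton_append, List.prod_append, List.prod_singleton, tupleProducts_cons, Finset.mem_image]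
    exact ⟨(ps.prod, p), Finset.mem_product.2 ⟨ih hps, mem_gridPiece_gridIndex hc hp.1 hp.2.1 hp.2.2⟩, rfl⟩

/-- **A matching `n` lies in the tuple product set of `τ`.** [cite: Polymath8b2014, §4.5, p. 17] -/
theorem mem_tupleProducts_of_idxList_eq (hc : Monotone c) {n : ℕ} (hn : n ≠ 0)
    (hfac : ∀ p ∈ n.primeFactorsList, c 0 < p ∧ p ≤ c (J + 1)) {r : ℕ} {τ : Fin r → ℕ}
    (hτ : idxList c J n = List.ofFn τ) : n ∈ tupleProducts (tuplePieces c τ) := by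
  have h := prod_mem_tupleProducts hc n.primeFactorsList
    (fun p hp => ⟨Nat.prime_of_mem_primeFactorsList hp, hfac p hp⟩)
  rw [Nat.prod_primeFactorsList hn] at h
  have hmap : (n.primeFactorsList.map fun p => gridPiece c (gridIndex c J p)) =
      List.ofFn fun i => gridPiece c (τ i) := by
    rw [show (fun p => gridPiece c (gridIndex c J p)) = (gridPiece c) ∘ (gridIndex c J) from rfl,
      ← List.map_map, ← idxList, hτ, List.map_ofFn]
    rfl
  rwa [hmap] at h

/-- **The convolution majorises the indicator**: for `n ∈ tupleProducts (P :: Ps)` (all members primes),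
`1 ≤ (1_{tupleProducts Ps} ⋆ 1_P)(n)`, whether or not the sets are increasing. [folklore] -/
theorem one_le_conv_of_mem_tupleProducts {P : Finset ℕ} {Ps : List (Finset ℕ)}
    (hprime : ∀ Q ∈ P :: Ps, ∀ p ∈ Q, p.Prime) {n : ℕ} (hn : n ∈ tupleProducts (P :: Ps)) :
    1 ≤ (setIndicatorAF (tupleProducts Ps) * setIndicatorAF P) n := by
  rw [tupleProducts_cons, Finset.mem_image] at hn
  obtain ⟨⟨d, p⟩, hdp, rfl⟩ := hn
  rw [Finset.mem_product] at hdp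
  obtain ⟨hd, hp⟩ := hdp
  have hd0 : d ≠ 0 := (pos_of_mem_tupleProducts (fun Q hQ => hprime Q (List.mem_cons_of_mem _ hQ)) d hd).ne'
  have hp0 : p ≠ 0 := (hprime P List.mem_cons_self p hp).ne_zero
  rw [ArithmeticFunction.mul_apply]
  have hmem : (d, p) ∈ (d * p).divisorsAntidiagonal := by
    rw [Nat.mem_divisorsAntidiagonal]
    exact ⟨rfl, mul_ne_zero hd0 hp0⟩
  have hnn : ∀ x ∈ (d * p).divisorsAntidiagonal,
      0 ≤ setIndicatorAF (tupleProducts Ps) x.1 * setIndicatorAF P x.2 := fun x _ => by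
    refine mul_nonneg ?_ ?_ <;> (rw [setIndicatorAF_apply]; split_ifs <;> norm_num)
  refine le_trans (le_of_eq ?_) (Finset.single_le_sum hnn hmem)
  simp only [setIndicatorAF_apply, if_pos (show d ∈ tupleProducts Ps ∧ d ≠ 0 from ⟨hd, hd0⟩),
    if_pos (show p ∈ P ∧ p ≠ 0 from ⟨hp, hp0⟩), mul_one]

/-- `tuplePieces` of a tuple with `r = s + 1` entries splits off the piece of the LAST index. [folklore] -/
theorem tuplePieces_succ (c : ℕ → ℕ) {s : ℕ} (τ : Fin (s + 1) → ℕ) :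
    tuplePieces c τ = gridPiece c (τ (Fin.last s)) :: tuplePieces c (fun i : Fin s => τ i.castSucc) := by
  rw [tuplePieces, tuplePieces, List.ofFn_succ', List.concat_eq_append, List.reverse_append,
    List.reverse_singleton, List.singleton_append]

end Products

/-! ### Strictly increasing tuples: the indicator is the convolution, and the box -/

section Good

variable {c : ℕ → ℕ} {J : ℕ}

/-- For a strictly increasing tuple the pieces are increasing sets (largest first). [folklore] -/
theorem pieces_pairwise_of_strictMono (hc : Monotone c) {r : ℕ} {τ : Fin r → ℕ} (hτ : StrictMono τ) :
    (tuplePieces c τ).Pairwise fun A B => ∀ b ∈ B, ∀ a ∈ A, b < a := by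
  rw [tuplePieces, List.pairwise_reverse, List.pairwise_ofFn]
  intro i j hij b hb a ha
  -- here `b ∈ P_{τ i}`, `a ∈ P_{τ j}`, `i < j`
  obtain ⟨-, hb2, -⟩ := (mem_gridPiece c).1 hb
  obtain ⟨ha1, -, -⟩ := (mem_gridPiece c).1 ha
  have h1 : τ i + 1 ≤ τ j := hτ hij
  exact lt_of_le_of_lt (hb2.trans (hc h1)) ha1

/-- Elements of a tuple product set come from a list of members, one from each set. [folklore] -/
theorem exists_forall₂_of_mem_tupleProducts : ∀ {Ps : List (Finset ℕ)} {n : ℕ}, n ∈ tupleProducts Ps →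
    ∃ qs : List ℕ, List.Forall₂ (fun q P => q ∈ P) qs Ps ∧ qs.prod = n
  | [], n, hn => by
    simp only [tupleProducts_nil, Finset.mem_singleton] at hn
    exact ⟨[], List.Forall₂.nil, by simp [hn]⟩
  | P :: Ps, n, hn => by
    rw [tupleProducts_cons, Finset.mem_image] at hn
    obtain ⟨⟨d, p⟩, hdp, rfl⟩ := hn
    rw [Finset.mem_product] at hdp
    obtain ⟨qs, hqs, hprod⟩ := exists_forall₂_of_mem_tupleProducts hdp.1
    refine ⟨p :: qs, List.Forall₂.cons hdp.2 hqs, ?_⟩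
    rw [List.prod_cons, hprod, mul_comm]

/-- **Conversely, every element of the product set of a strictly increasing tuple matches it.** [cite: Polymath8b2014, §4.5, p. 17] -/
theorem idxList_eq_of_mem_tupleProducts (hc : Monotone c) {r : ℕ} {τ : Fin r → ℕ} (hτ : StrictMono τ)
    (hτJ : ∀ i, τ i ≤ J) {n : ℕ} (hn : n ∈ tupleProducts (tuplePieces c τ)) :
    idxList c J n = List.ofFn τ := by
  obtain ⟨qs, hqs, hprod⟩ := exists_forall₂_of_mem_tupleProducts hn
  -- `ps = qs.reverse` lists the primes in increasing order of the pieces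
  set ps := qs.reverse with hps
  have hps2 : List.Forall₂ (fun q P => q ∈ P) ps (List.ofFn fun i => gridPiece c (τ i)) := by
    have := List.forall₂_reverse_iff.2 hqs
    rwa [tuplePieces, List.reverse_reverse] at this
  have hlen : ps.length = r := by rw [hps2.length_eq, List.length_ofFn]
  have hget : ∀ (i : ℕ) (hi : i < ps.length), ps[i] ∈ gridPiece c (τ ⟨i, hlen ▸ hi⟩) := by
    intro i hi
    have h := (List.forall₂_iff_get.1 hps2).2 i hi (by rw [List.length_ofFn]; exact hlen ▸ hi)
    simpa using h
  have hprime : ∀ p ∈ ps, p.Prime := by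
    intro p hp
    obtain ⟨i, hi, rfl⟩ := List.getElem_of_mem hp
    exact ((mem_gridPiece c).1 (hget i hi)).2.2
  have hsorted : ps.SortedLE := by
    rw [List.sortedLE_iff_getElem_le_getElem_of_le]
    intro i j hi hj hij
    rcases hij.lt_or_eq with hlt | rfl
    · have ha := (mem_gridPiece c).1 (hget i hi)
      have hb := (mem_gridPiece c).1 (hget j hj)
      have h1 : τ ⟨i, hlen ▸ hi⟩ + 1 ≤ τ ⟨j, hlen ▸ hj⟩ := hτ (show (⟨i, hlen ▸ hi⟩ : Fin r) < ⟨j, hlen ▸ hj⟩ from hlt)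
      exact (ha.2.1.trans ((hc h1).trans hb.1.le))
    · exact le_rfl
  have hpsprod : ps.prod = n := by rw [hps, List.prod_reverse, hprod]
  have hpf : n.primeFactorsList = ps :=
    ((Nat.primeFactorsList_unique hpsprod hprime).eq_of_sortedLE hsorted (Nat.primeFactorsList_sorted n)).symm
  rw [idxList, hpf]
  apply List.ext_getElem
  · rw [List.length_map, List.length_ofFn, hlen]
  · intro i h1 h2
    rw [List.getElem_map, List.getElem_ofFn]
    have hi : i < ps.length := by rwa [List.length_map] at h1
    exact gridIndex_of_mem_gridPiece hc (hτJ _) (hget i hi)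

/-- **The box of a tuple product** (lower): `∏_i c_{τ i} < n` for `n ∈ tupleProducts (tuplePieces c τ)`,
`r ≥ 1`. [folklore] -/
theorem prod_lt_of_mem_tupleProducts {r : ℕ} (hr : 1 ≤ r) {τ : Fin r → ℕ} {n : ℕ}
    (hn : n ∈ tupleProducts (tuplePieces c τ)) : ∏ i, c (τ i) < n := by
  obtain ⟨s, rfl⟩ : ∃ s, r = s + 1 := ⟨r - 1, by omega⟩
  clear hr
  induction s generalizing n with
  | zero =>
    rw [tuplePieces_succ, tupleProducts_cons, Finset.mem_image] at hn
    obtain ⟨⟨d, p⟩, hdp, rfl⟩ := hn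
    rw [Finset.mem_product] at hdp
    have hd : d ∈ tupleProducts (tuplePieces c (fun i : Fin 0 => τ i.castSucc)) := hdp.1
    rw [tuplePieces, List.ofFn_zero, List.reverse_nil, tupleProducts_nil, Finset.mem_singleton] at hd
    subst hd
    rw [Fin.prod_univ_one, one_mul]
    exact ((mem_gridPiece c).1 hdp.2).1
  | succ s ih =>
    rw [tuplePieces_succ, tupleProducts_cons, Finset.mem_image] at hn
    obtain ⟨⟨d, p⟩, hdp, rfl⟩ := hn
    rw [Finset.mem_product] at hdp
    have h1 := ih (τ := fun i : Fin (s + 1) => τ i.castSucc) hdp.1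
    have h2 := ((mem_gridPiece c).1 hdp.2).1
    rw [Fin.prod_univ_castSucc]
    exact Nat.mul_lt_mul'' h1 h2

/-- **The box of a tuple product** (upper): `n ≤ ∏_i c_{τ i + 1}`. [folklore] -/
theorem le_prod_of_mem_tupleProducts {r : ℕ} {τ : Fin r → ℕ} {n : ℕ}
    (hn : n ∈ tupleProducts (tuplePieces c τ)) : n ≤ ∏ i, c (τ i + 1) := by
  induction r generalizing n with
  | zero =>
    rw [tuplePieces, List.ofFn_zero, List.reverse_nil, tupleProducts_nil, Finset.mem_singleton] at hn
    subst hn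
    simp
  | succ s ih =>
    rw [tuplePieces_succ, tupleProducts_cons, Finset.mem_image] at hn
    obtain ⟨⟨d, p⟩, hdp, rfl⟩ := hn
    rw [Finset.mem_product] at hdp
    have h1 := ih (τ := fun i : Fin s => τ i.castSucc) hdp.1
    have h2 := ((mem_gridPiece c).1 hdp.2).2.1
    rw [Fin.prod_univ_castSucc]
    exact Nat.mul_le_mul h1 h2

/-! ### The model value of `λ_F` on a tuple product set -/

/-- The model value attached to a tuple: `Σ_{S ⊆ Fin r} (−1)^{#S} F(Σ_{i ∈ S} u(τ i))`. [cite: Polymath8b2014, §4.5, p. 17] -/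
def modelValue (F : ℝ → ℝ) (u : ℕ → ℝ) {r : ℕ} (τ : Fin r → ℕ) : ℝ :=
  ∑ S ∈ (univ : Finset (Fin r)).powerset, (-1 : ℝ) ^ #S * F (∑ i ∈ S, u (τ i))

/-- `|modelValue| ≤ 2^r sup|F|`. [folklore] -/
theorem abs_modelValue_le {F : ℝ → ℝ} {M : ℝ} (hM : ∀ t, |F t| ≤ M) (u : ℕ → ℝ) {r : ℕ} (τ : Fin r → ℕ) :
    |modelValue F u τ| ≤ 2 ^ r * M := by
  unfold modelValue
  refine (Finset.abs_sum_le_sum_abs _ _).trans ?_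
  calc ∑ S ∈ (univ : Finset (Fin r)).powerset, |(-1 : ℝ) ^ #S * F (∑ i ∈ S, u (τ i))|
      ≤ ∑ _S ∈ (univ : Finset (Fin r)).powerset, M := Finset.sum_le_sum fun S _ => by
        rw [abs_mul, abs_pow, abs_neg, abs_one, one_pow, one_mul]; exact hM _
    _ = 2 ^ r * M := by
        rw [Finset.sum_const, Finset.card_powerset, Finset.card_univ, Fintype.card_fin, nsmul_eq_mul]
        push_cast; ring

/-- **The model value of `λ_F` only depends on the tuple**: for `n` in the product set of a strictly
increasing tuple, `lambdaModel F (u ∘ gridIndex) n = modelValue F u τ`. [cite: Polymath8b2014, §4.5, p. 17] -/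
theorem lambdaModel_eq_modelValue (hc : Monotone c) {r : ℕ} {τ : Fin r → ℕ} (hτ : StrictMono τ)
    (hτJ : ∀ i, τ i ≤ J) {n : ℕ} (hn : n ∈ tupleProducts (tuplePieces c τ)) (F : ℝ → ℝ) (u : ℕ → ℝ) :
    lambdaModel F (fun p => u (gridIndex c J p)) n = modelValue F u τ := by
  obtain ⟨qs, hqs, hprod⟩ := exists_forall₂_of_mem_tupleProducts hn
  set ps := qs.reverse with hps
  have hps2 : List.Forall₂ (fun q P => q ∈ P) ps (List.ofFn fun i => gridPiece c (τ i)) := by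
    have := List.forall₂_reverse_iff.2 hqs
    rwa [tuplePieces, List.reverse_reverse] at this
  have hlen : ps.length = r := by rw [hps2.length_eq, List.length_ofFn]
  have hget : ∀ (i : ℕ) (hi : i < ps.length), ps[i] ∈ gridPiece c (τ ⟨i, hlen ▸ hi⟩) := by
    intro i hi
    have h := (List.forall₂_iff_get.1 hps2).2 i hi (by rw [List.length_ofFn]; exact hlen ▸ hi)
    simpa using h
  have hprime : ∀ p ∈ ps, p.Prime := by
    intro p hp
    obtain ⟨i, hi, rfl⟩ := List.getElem_of_mem hp
    exact ((mem_gridPiece c).1 (hget i hi)).2.2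
  -- distinct entries: the pieces are disjoint
  have hinj : ∀ (i j : ℕ) (hi : i < ps.length) (hj : j < ps.length), ps[i] = ps[j] → i = j := by
    intro i j hi hj hij
    by_contra hne
    rcases Nat.lt_or_gt_of_ne hne with hlt | hlt
    · have ha := (mem_gridPiece c).1 (hget i hi)
      have hb := (mem_gridPiece c).1 (hget j hj)
      have h1 : τ ⟨i, hlen ▸ hi⟩ + 1 ≤ τ ⟨j, hlen ▸ hj⟩ := hτ (show (⟨i, hlen ▸ hi⟩ : Fin r) < ⟨j, hlen ▸ hj⟩ from hlt)
      have := lt_of_le_of_lt (ha.2.1.trans (hc h1)) hb.1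
      omega
    · have ha := (mem_gridPiece c).1 (hget j hj)
      have hb := (mem_gridPiece c).1 (hget i hi)
      have h1 : τ ⟨j, hlen ▸ hj⟩ + 1 ≤ τ ⟨i, hlen ▸ hi⟩ := hτ (show (⟨j, hlen ▸ hj⟩ : Fin r) < ⟨i, hlen ▸ hi⟩ from hlt)
      have := lt_of_le_of_lt (ha.2.1.trans (hc h1)) hb.1
      omega
  have hnodup : ps.Nodup := List.nodup_iff_injective_get.2 fun i j hij =>
    Fin.ext (hinj i j i.2 j.2 hij)
  have hpsprod : ps.prod = n := by rw [hps, List.prod_reverse, hprod]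
  have hperm := Nat.primeFactorsList_unique hpsprod hprime
  have hpf : n.primeFactors = ps.toFinset := by
    rw [Nat.primeFactors, List.toFinset_eq_of_perm _ _ hperm.symm]
  -- the injection `Fin r → ℕ`, `i ↦ ps[i]`
  set f : Fin r → ℕ := fun i => ps[(i : ℕ)]'(hlen ▸ i.2) with hf
  have hfinj : Function.Injective f := fun i j hij => Fin.ext (hinj i j _ _ hij)
  have hmap : ps.toFinset = (univ : Finset (Fin r)).image f := by
    ext p
    rw [List.mem_toFinset, Finset.mem_image]
    constructor
    · intro hp
      obtain ⟨i, hi, rfl⟩ := List.getElem_of_mem hp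
      exact ⟨⟨i, hlen ▸ hi⟩, Finset.mem_univ _, rfl⟩
    · rintro ⟨i, -, rfl⟩
      exact List.getElem_mem _
  unfold lambdaModel modelValue
  rw [hpf, hmap, Finset.powerset_image,
    Finset.sum_image fun S _ T _ hST => Finset.image_injective hfinj hST]
  refine Finset.sum_congr rfl fun S _ => ?_
  rw [Finset.card_image_of_injective _ hfinj, Finset.sum_image fun i _ j _ hij => hfinj hij]
  congr 2
  refine Finset.sum_congr rfl fun i _ => ?_
  simp only [hf]
  rw [gridIndex_of_mem_gridPiece hc (hτJ i) (hget i (hlen ▸ i.2))]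

end Good

end Literature.NumberTheory.Sieve
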